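import Summits.NavierStokesRegularity.NavierStokesRegularity.Theorems.SoloRefuteChebiam2025
import Summits.NavierStokesRegularity.NavierStokesRegularity.Theorems.SoloRefuteTaghizadeh2026Step29E
import Mathlib.Analysis.Calculus.BumpFunction.Basic
import Literature.Claims.NS.Chadwick2023
import Literature.Analysis.FluidPDE.NSQuasipotential
import HarnessLib
import Literature.Claims.NS.Vukolov2026
import Literature.Analysis.FunctionSpaces.LadyzhenskayaTorus

/-!
# REVIEW-RUNBOOK sanity lemmas — joint satisfiability of hypothesis telescopes of the NS-claims
# sweep (client `ns-claims` of the ops review-runbook generator)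

Card (2)(b) («non-vacuity») of `run/shared/lean/ns/ns-claims/REVIEW-RUNBOOK.md`.  Two refutation
statements of the D-0090 NS-claims sweep carry standing hypotheses on their objects; this file records,
as closed theorems `∃ objects, h₁ ∧ … ∧ hₙ` (the shape the generator's probe matches), that the
hypotheses are met together by explicit, non-degenerate objects:

* `Chebiam2025.isDatum_iff_eq_zero` (`Theorems/SoloRefuteChebiam2025.lean`): an OPEN and BOUNDED
  domain `Ω ⊆ ℝ³` — the open unit ball;
* `Taghizadeh2026.not_Step29E` (`Theorems/SoloRefuteTaghizadeh2026Step29E.lean`): `ν = λ = 1 > 0` and an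
  ADMISSIBLE CUTOFF `χ` (`IsCutoff`: `C^∞`, `≡ 1` on `[0,1]`, `≡ 0` on `[2,∞)`, `≥ 0`) — Mathlib's smooth
  bump function on `ℝ` centred at `0` with radii `1 < 2` (`ContDiffBump`).  So the cutoff class the
  refutation quantifies over is inhabited (the kill does not rest on an empty class).

Review evidence only (`--supports`; the file closes no item); nothing here is used by a theorem of the
tree; no definitions, no `sorry`, standard axioms.
-/

noncomputable section

namespace Summit.NavierStokesRegularity.NavierStokesRegularity.Theorems.RunbookNsClaims

open Literature.Claims.NS

/-! ### `Chebiam2025.isDatum_iff_eq_zero` -/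

/-- (b) **The two hypotheses of `Chebiam2025.isDatum_iff_eq_zero` hold together**: the open unit ball of
`E3 = ℝ³` is open and bounded. [folklore] -/
theorem isDatum_iff_eq_zero_hypotheses :
    ∃ Ω : Set Chebiam2025.E3, IsOpen Ω ∧ Bornology.IsBounded Ω :=
  ⟨Metric.ball 0 1, Metric.isOpen_ball, Metric.isBounded_ball⟩

/-! ### `Taghizadeh2026.not_Step29E` -/

/-- The smooth bump function on `ℝ` centred at `0`, `≡ 1` on `[-1, 1]`, supported in `(-2, 2)` (Mathlib's
`ContDiffBump` with radii `1 < 2`), is an admissible cutoff in the sense of `Taghizadeh2026.IsCutoff`.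
[folklore] -/
theorem isCutoff_bump : Taghizadeh2026.IsCutoff (⟨1, 2, one_pos, one_lt_two⟩ : ContDiffBump (0 : ℝ)) where
  smooth := ContDiffBump.contDiff _
  eq_one s hs := by
    refine ContDiffBump.one_of_mem_closedBall _ ?_
    rw [Metric.mem_closedBall, dist_zero_right, Real.norm_eq_abs]
    show |s| ≤ 1
    exact abs_le.2 ⟨by linarith [hs.1], hs.2⟩
  eq_zero s hs := by
    refine ContDiffBump.zero_of_le_dist _ ?_
    rw [dist_zero_right, Real.norm_eq_abs]
    show (2 : ℝ) ≤ |s|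
    exact hs.trans (le_abs_self s)
  nonneg s := ContDiffBump.nonneg _

/-- (b) **The three hypotheses of `Taghizadeh2026.not_Step29E` hold together, non-degenerately**:
`ν = 1 > 0`, `λ = 1 > 0`, and the admissible cutoff class `IsCutoff` is INHABITED (by the smooth bump
function `isCutoff_bump`). [folklore] -/
theorem not_Step29E_hypotheses :
    ∃ (ν lam : ℝ) (χ : ℝ → ℝ), 0 < ν ∧ 0 < lam ∧ Taghizadeh2026.IsCutoff χ :=
  ⟨1, 1, _, one_pos, one_pos, isCutoff_bump⟩


/-! ### `Chadwick2023.step3_rigid` (appended 2026-09-04) -/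

/-- The zero velocity field has stokeslet decay (every derivative vanishes). [folklore] -/
theorem hasStokesletDecay_zero :
    Chadwick2023.HasStokesletDecay (0 : EuclideanSpace ℝ (Fin 3) → EuclideanSpace ℝ (Fin 3)) :=
  fun n => ⟨0, fun x => by rw [iteratedFDeriv_zero, Pi.zero_apply, norm_zero, mul_zero]⟩

/-- (b) **The five object hypotheses of `Chadwick2023.step3_rigid` hold together — at the REST STATE**:
`ν = 1 > 0`, `t₀ = 0`, `T = 1 > 0`, `u ≡ 0`, `p ≡ 0` is a member of the paper's ansatz class on
`[t₀, t₀ + T]` (a classical Navier–Stokes solution — the tree's `isClassicalNSSolutionOn_zero` — whose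
time slices decay like a stokeslet, trivially), and the constant path `X ≡ 0` is a Lagrangian trajectory
of `u ≡ 0`.  An honest but DEGENERATE witness: it certifies that the class the rigidity statement
quantifies over is not empty (the implication is not vacuous), not that it contains an interesting flow;
the statement's content (`u` constant along trajectories for EVERY member) is exactly what a
non-trivial member would test. [folklore] -/
theorem step3_rigid_hypotheses :
    ∃ (ν t₀ T : ℝ) (u : ℝ → EuclideanSpace ℝ (Fin 3) → EuclideanSpace ℝ (Fin 3))
      (p : ℝ → EuclideanSpace ℝ (Fin 3) → ℝ) (X : ℝ → EuclideanSpace ℝ (Fin 3)),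
      0 < ν ∧ 0 ≤ t₀ ∧ 0 < T ∧ Chadwick2023.IsSolutionOn (Set.Icc t₀ (t₀ + T)) ν u p ∧
        Chadwick2023.IsTrajectoryOn u (Set.Icc t₀ (t₀ + T)) X :=
  ⟨1, 0, 1, 0, 0, fun _ => 0, one_pos, le_rfl, one_pos,
    ⟨Literature.Analysis.FluidPDE.isClassicalNSSolutionOn_zero _ _, fun _ _ => hasStokesletDecay_zero⟩,
    fun t _ => hasDerivWithinAt_const t _ _⟩

end Summit.NavierStokesRegularity.NavierStokesRegularity.Theorems.RunbookNsClaims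

end

namespace Summit.NavierStokesRegularity.NavierStokesRegularity.Theorems.RunbookNsClaims

/-! ### `Baev2022.eq_zero_of_convect_self_eq_zero_of_decay` (appended 2026-09-04, gen 91) -/

/-- (b) **The three hypotheses of `Baev2022.eq_zero_of_convect_self_eq_zero_of_decay` hold together —
at the ZERO FIELD** on `E = ℝ`: `U ≡ 0` is `C¹`, decays (`(1 + ‖y‖)·‖U y‖ = 0 ≤ 0`, constant `C = 0`),
and has straight streamlines (`DU(x)[U x] = 0`).  Degenerate BY THE THEOREM ITSELF: its conclusion is
`U = 0`, so the zero field is the ONLY member of the class it quantifies over — the witness certifies that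
the hypothesis telescope is consistent (the certified implication is not vacuous); that the class has no
other member is exactly the statement's content. [folklore] -/
theorem eq_zero_of_convect_self_eq_zero_of_decay_hypotheses :
    ∃ U : ℝ → ℝ, ContDiff ℝ 1 U ∧ (∃ C : ℝ, ∀ y, (1 + ‖y‖) * ‖U y‖ ≤ C) ∧
      ∀ x, fderiv ℝ U x (U x) = 0 :=
  ⟨fun _ => 0, contDiff_const, ⟨0, fun y => by simp⟩, fun x => by simp⟩

end Summit.NavierStokesRegularity.NavierStokesRegularity.Theorems.RunbookNsClaims

namespace Summit.NavierStokesRegularity.NavierStokesRegularity.Theorems.RunbookNsClaims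

/-! ### `Vukolov2026.jacRank` is the dimension of a FINITE-dimensional space (review-runbook «card» side fact, 2026-09-05)

`jacRank V x = Module.finrank ℝ (LinearMap.range (fderiv ℝ V x).toLinearMap)` — the rank of the Jacobian `∇V(x)`.
`Module.finrank` is the default `0` for a space that is not finite-dimensional; the range of the derivative is a subspace of
`E3 = EuclideanSpace ℝ (Fin 3)`, hence finite-dimensional for EVERY field `V` and point `x` (no smoothness needed — at a
non-differentiable point `fderiv` is the zero map and the rank is the genuine `0`). -/

/-- (c) **The range of the Jacobian is finite-dimensional** for every `V : ℝ³ → ℝ³` and `x`: the `Module.finrank` defining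
`Vukolov2026.jacRank` is a genuine dimension (`≤ 3`). [folklore] -/
theorem jacRank_range_finite (V : Literature.Claims.NS.Vukolov2026.E3 → Literature.Claims.NS.Vukolov2026.E3)
    (x : Literature.Claims.NS.Vukolov2026.E3) :
    Module.Finite ℝ (LinearMap.range (fderiv ℝ V x).toLinearMap) :=
  inferInstance

/-- The same fact spelled `FiniteDimensional`. [folklore] -/
theorem jacRank_range_finiteDimensional (V : Literature.Claims.NS.Vukolov2026.E3 → Literature.Claims.NS.Vukolov2026.E3)
    (x : Literature.Claims.NS.Vukolov2026.E3) :
    FiniteDimensional ℝ (LinearMap.range (fderiv ℝ V x).toLinearMap) :=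
  inferInstance

/-- Hence `jacRank V x ≤ 3` at every point. [folklore] -/
theorem jacRank_le_three (V : Literature.Claims.NS.Vukolov2026.E3 → Literature.Claims.NS.Vukolov2026.E3)
    (x : Literature.Claims.NS.Vukolov2026.E3) : Literature.Claims.NS.Vukolov2026.jacRank V x ≤ 3 := by
  rw [Literature.Claims.NS.Vukolov2026.jacRank]
  calc Module.finrank ℝ (LinearMap.range (fderiv ℝ V x).toLinearMap)
      ≤ Module.finrank ℝ Literature.Claims.NS.Vukolov2026.E3 := Submodule.finrank_le _
    _ = 3 := by simp

end Summit.NavierStokesRegularity.NavierStokesRegularity.Theorems.RunbookNsClaims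

namespace Summit.NavierStokesRegularity.NavierStokesRegularity.Theorems.RunbookNsClaims

/-! ### `Torus.gradNormSq v = ∫ ∑ᵢ ‖∂ᵢv‖²` integrates an INTEGRABLE function for smooth `v` (review-runbook «integral» side fact, 2026-09-05)

The Bochner integral of a non-integrable function is the default `0`.  `gradNormSq` takes an ARBITRARY field `v` on the torus,
so the side fact is argument-dependent (the docstring: «Meaningful for C¹ fields»); for a SMOOTH field (`Torus.IsSmooth v`, the
hypothesis every statement of the clients carries) the integrand is continuous on the compact torus, hence integrable. -/

/-- (c) **For a smooth field the integrand of `gradNormSq` is integrable** (continuous on the compact torus): under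
`Torus.IsSmooth v` the integral `∫ x, ∑ i, ‖∂ᵢ v x‖²` is a genuine one. [folklore] -/
theorem gradNormSq_integrable {d : Type*} [Fintype d] [DecidableEq d]
    {v : UnitAddTorus d → EuclideanSpace ℝ d} (hv : Literature.Analysis.FunctionSpaces.Torus.IsSmooth v) :
    MeasureTheory.Integrable
      (fun x : UnitAddTorus d => ∑ i, ‖Literature.Analysis.FunctionSpaces.Torus.partialDeriv i v x‖ ^ 2) :=
  (continuous_finsetSum _ fun i _ => (hv.partialDeriv i).continuous.norm.pow 2).integrable_unitAddTorus

end Summit.NavierStokesRegularity.NavierStokesRegularity.Theorems.RunbookNsClaims
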